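import Summits.BirchSwinnertonDyer.BirchSwinnertonDyer.Theses.ErratumRoadFive
import Summits.BirchSwinnertonDyer.BirchSwinnertonDyer.Theorems.ErratumRoadFiveKatoFframeNonvanishingOfPrint
import HarnessLib

/-!
# Route `ErratumRoadFive`, crux `EulerHalfNotRamNoInertSetAtFive` (stmt-BirchSwinnertonDyer-19715), line `kato_Fframe` r5.5 —
# **crux 19715 BY NAME ⟸ SEVEN named Literature facts + the TWO research valuation inequalities, nothing else**

LEAD seat `bsd-line-er5-p1` (g11), `--supports stmt-BirchSwinnertonDyer-19715`; one theorem (no definition, no named fact, no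
instance, no notation, no `sorry`). The crux-named corollary of the ROUTE-INDEPENDENT module
`ErratumRoadFiveKatoFframeNonvanishingOfPrint` (this seat): there `Typed.MissingUpperBoundAt W p` holds on ALL of
X11b ∩ {p ≥ 5, ρ̄ onto} given the named facts {GZK, Kato 12.5 (4) realisability, F1′, H2Xʳ, GZ86 I.(7.3), Venerucci 2016
(`Venerucci2016_kummerLog_bottomLayer_ne_zero_split`), BDV 2022 (`BertoliniDarmonVenerucci2022_kummerLog_bottomLayer_ne_zero`)}
(p768048) and the two RESEARCH valuation inequalities `hVsplit` / `hVnonsplit` (integral rank-one Perrin-Riou values at split /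
non-split multiplicative `p`; not in print). Compared with `ErratumRoadFiveKatoFframeClosureAtomic.eulerHalfNotRamNoInertSetAtFive_of_atoms`
(p766911, LEAD g10) the two anonymous PRINT binders `hNZsplit` / `hNZnonsplit` are gone — discharged by name from the Literature facts.
This file imports the route file and the route-independent engine only (theses-cone hygiene).

HONEST FRAMING: CONDITIONAL (seven named-fact hypotheses + two research binders); the crux's three residual hypotheses (`¬Ram`,
`p ∣ ∏c`, «no inert-set datum») are idle, as in every closure of this line; closes nothing; credits no registered stub. No summit
statement is proved; BSD is proved for no curve.

References: [Venerucci2016] Thm. A, Thm. B; [BertoliniDarmonVenerucci2022] Thm. A; [Kim2022] Thm. 2.1, Cor. 2.3; [Kato2004Asterisque]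
Thm. 12.4 (3), Thm. 12.5 (4) (pp. 221–222), (14.9.3), (14.14.2); [GrossZagier1986] Thm. I.(7.3); [Darmon2004] Thm. 3.22.
-/

-- the summit and its single problem are both named `BirchSwinnertonDyer` (registry layout D-0017)
set_option linter.dupNamespace false
set_option autoImplicit false

noncomputable section

open scoped Classical
open Field WeierstrassCurve
open Literature.NumberTheory.GaloisRepresentations
open Literature.NumberTheory.EllipticCurves Literature.NumberTheory.EllipticCurves.Kato2004
open Literature.NumberTheory.EllipticCurves.Kato2004.EulerSystemValues
open Literature.NumberTheory.EllipticCurves.Rank1Residual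
open Literature.NumberTheory.EllipticCurves.Rank1Residual.Typed
open Summit.BirchSwinnertonDyer.Rank1Residual
open Summit.BirchSwinnertonDyer.BirchSwinnertonDyer.Theses.ErratumRoadFive

namespace Summit.BirchSwinnertonDyer.BirchSwinnertonDyer.Theorems.ErratumRoadFiveKatoFframeClosureOfPrint

/-- **Crux 19715 `ErratumRoadFive.EulerHalfNotRamNoInertSetAtFive` BY NAME from SEVEN named facts {GZK, Kato 12.5 (4) realisability,
F1′, H2Xʳ, GZ86 I.(7.3), Venerucci 2016, BDV 2022} and the two RESEARCH valuation inequalities `hVsplit` / `hVnonsplit`** (its three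
residual hypotheses are idle). Proof: `ErratumRoadFiveKatoFframeNonvanishingOfPrint.missingUpperBoundAt_of_printedFacts_of_inequalities`.
CONDITIONAL; closes nothing. [cite: Kato2004Asterisque, Thm. 12.5 (4) (p. 222)] [cite: Venerucci2016, Thm. A and Thm. B]
[cite: BertoliniDarmonVenerucci2022, Thm. A] [cite: GrossZagier1986, Thm. I.(7.3)] [cite: Darmon2004, Thm. 3.22] -/
theorem eulerHalfNotRamNoInertSetAtFive_of_printedFacts_of_inequalities
    (hGZK : rank_eq_analyticRank_of_analyticRank_le_one)
    (hReal : exists_isAdmissibleZetaClass_of_imageContainsSL2)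
    (hF1 : lengthAt_fineSelmerDual_le_of_isAdmissibleZetaClass)
    (hH2X : exists_iwasawaH2Data_fineSelmerDual_embedding_countRankFree)
    (hGZ : GrossZagier1986_thm_I_7_3)
    (hV : Venerucci2016_kummerLog_bottomLayer_ne_zero_split)
    (hB : BertoliniDarmonVenerucci2022_kummerLog_bottomLayer_ne_zero)
    (hVsplit : ∀ (W : WeierstrassCurve ℚ) [W.IsElliptic] [W.IsGloballyMinimal] (p : ℕ) [Fact p.Prime]
      [ContinuousSMul ℤ_[p] (W.tateModule p)],
      ClassX11b W p → 5 ≤ p → Surj W p → W.HasSplitMultiplicativeReductionAtPrime p →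
      ∀ (h1 : W.mordellWeilRank = 1) (P : Fin W.mordellWeilRank → W.toAffine.Point),
        W.IsMordellWeilBasis P →
      ∀ (K : ZpExtension ℚ p) (hK : K.IsCyclotomic) (γ : absoluteGaloisGroup ℚ)
        (I : IwasawaH1Data W p K γ) (z₀ : I.H), K.IsTopGenerator γ → IsAdmissibleZetaClass W p K hK I z₀ →
      ∀ t : ℚ_[p], HasLocPKummerLog W p (layerZeroToTop W p K (I.proj 0 z₀)) t → t ≠ 0 →
      ∀ q : ℚ, shaAn W = (q : ℂ) →
        t.valuation -
            2 * (padicLogLocal W p (WeierstrassCurve.Affine.Point.map (Algebra.ofId ℚ ℚ_[p]) (P (Fin.cast h1.symm 0)))).valuation ≤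
          padicValRat p q + padicValNat p W.tamagawaProduct - 2 * padicValNat p W.torsionOrder - 1)
    (hVnonsplit : ∀ (W : WeierstrassCurve ℚ) [W.IsElliptic] [W.IsGloballyMinimal] (p : ℕ) [Fact p.Prime]
      [ContinuousSMul ℤ_[p] (W.tateModule p)],
      ClassX11b W p → 5 ≤ p → Surj W p → ¬ W.HasSplitMultiplicativeReductionAtPrime p →
      ∀ (h1 : W.mordellWeilRank = 1) (P : Fin W.mordellWeilRank → W.toAffine.Point),
        W.IsMordellWeilBasis P →
      ∀ (K : ZpExtension ℚ p) (hK : K.IsCyclotomic) (γ : absoluteGaloisGroup ℚ)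
        (I : IwasawaH1Data W p K γ) (z₀ : I.H), K.IsTopGenerator γ → IsAdmissibleZetaClass W p K hK I z₀ →
      ∀ t : ℚ_[p], HasLocPKummerLog W p (layerZeroToTop W p K (I.proj 0 z₀)) t → t ≠ 0 →
      ∀ q : ℚ, shaAn W = (q : ℂ) →
        t.valuation -
            2 * (padicLogLocal W p (WeierstrassCurve.Affine.Point.map (Algebra.ofId ℚ ℚ_[p]) (P (Fin.cast h1.symm 0)))).valuation ≤
          padicValRat p q + padicValNat p W.tamagawaProduct - 2 * padicValNat p W.torsionOrder - 1) :
    EulerHalfNotRamNoInertSetAtFive := by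
  intro W _ _ p _ hX h5 hSurj _hnRam _hTam _hNoS
  exact ErratumRoadFiveKatoFframeNonvanishingOfPrint.missingUpperBoundAt_of_printedFacts_of_inequalities
    hGZK hReal hF1 hH2X hGZ hV hB hVsplit hVnonsplit W p hX h5 hSurj

end Summit.BirchSwinnertonDyer.BirchSwinnertonDyer.Theorems.ErratumRoadFiveKatoFframeClosureOfPrint

end
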